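import Literature.AlgebraicTopology.CharacteristicClasses.PontryaginClassStability
import Literature.AlgebraicTopology.CharacteristicClasses.ConjugateBundle
import HarnessLib

/-!
# The complexification of a real form of a complex bundle: `V ⊗ ℂ ≅ E ⊕ Ē`, `p(V)` from `c(E)`

J. Milnor, J. Stasheff, *Characteristic Classes* (1974), §15: **Lemma 15.4** ("the
complexification `ω_ℝ ⊗ ℂ` of the underlying real bundle of a complex vector bundle `ω` is
canonically isomorphic to `ω ⊕ ω̄`") and **Cor. 15.5** (the Pontrjagin classes of `ω_ℝ` are
determined by the Chern classes of `ω`: `1 - p₁ + p₂ - ⋯ = (1 - c₁ + c₂ - ⋯)(1 + c₁ + c₂ + ⋯)`, so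
`p₁(ω_ℝ) = c₁(ω)² - 2 c₂(ω)`); F. Hirzebruch, *Topological Methods in Algebraic Geometry* (3rd ed.
1966), **Thm. 4.5.1** (`p̃(ρξ) = c(ξ) c(ξ*)` for the realification `ρξ` of a `U(q)`-bundle `ξ`,
proved by the unitary change of basis conjugating the real form of `U(q)` into `diag(A, Ā)`).

The tree attaches Pontryagin classes to Mathlib real vector bundles `V`
(`pontryaginClass F V i = (-1)ⁱ c₂ᵢ(V ⊗ ℂ)`, `Complexification.lean`) and Chern classes to bundled
`ComplexVectorBundle`s `E`; the "underlying real bundle" of `E` is therefore presented by a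
**real form**: a real vector bundle `V` with fibrewise real-linear isomorphisms `φ_x : V_x ≅ E_x`
whose total maps are continuous in both directions (for the tangent bundle of an almost complex
manifold and `E = (TM, J)` this is the content of `ComplexifiedTangentSplitting.lean`; here for any
`E`, e.g. sums of tautological line bundles).  We prove:

* `VectorBundle.continuousAdd_fiber`, `VectorBundle.continuousConstSMul_fiber` — the fibres of a
  vector bundle are topological vector spaces (transport along the trivialisation at the point);
  `continuous_add_smul_fibre`, `continuous_smul_fibre'` — fibrewise combinations `σ + c τ`, `c σ` of
  continuous maps into a vector bundle over any normed field are continuous (the real cases are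
  `Literature.Topology.FourManifolds.continuous_add_fibre` / `continuous_smul_fibre`);
* `Complexification.realFormSplitEquiv φ` — the complex-linear fibre isomorphism
  `V_x ⊗ ℂ ≅ E_x ⊕ Ē_x`, `u + i v ↦ (φ u + i φ v, (φ u - i φ v)‾)` (Milnor–Stasheff's
  `v ⊗ 1 ∓ (iv) ⊗ i`), with inverse `(a, b̄) ↦ φ⁻¹(½ (a + b)) + i φ⁻¹(½ i (b - a))`
  (`rfPlus`, `rfMinus`, `rfInv` and their linearity / inverse identities);
* **`Complexification.realFormIso`** — Lemma 15.4: `V ⊗ ℂ ≅ E ⊕ Ē` as complex vector bundles;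
* **`pontryaginClass_eq_of_realForm`** — `pᵢ(V) = (-1)ⁱ c₂ᵢ(E ⊕ Ē)`, and in degree four
  **`pontryaginClass_one_eq_of_realForm`**: `p₁(V) = c₁(E) ⌣ c₁(E) - 2 c₂(E) ∈ H⁴(B; ℤ)`
  (Cor. 15.5 / Thm. 4.5.1), through `chernClassZ_two_directSum_conjugate`:
  `c₂(E ⊕ Ē) = 2 c₂(E) - c₁(E)²` (Whitney sum formula and `c₁(Ē) = -c₁(E)`, `c₂(Ē) = c₂(E)` of
  `ConjugateBundle.lean`).

The real structure on the fibres `E_x` is any `ℝ`-module structure compatible with the complex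
one (`[Module ℝ (E.E x)] [IsScalarTower ℝ ℂ (E.E x)]`, as carried by submodules, products and
function spaces), so that the statements apply verbatim to concrete bundles; inside the
construction the fibres are additive groups through the scoped
`ComplexVectorBundle.instAddCommGroupFiber`.  Everything is proved; no named facts.

## References

* J. Milnor, J. Stasheff, *Characteristic Classes*, Ann. of Math. Stud. 76, Princeton UP 1974,
  §15, Lemma 15.4 and Cor. 15.5. [MilnorStasheffAMS76]
* F. Hirzebruch, *Topological Methods in Algebraic Geometry*, 3rd ed., Grundlehren 131, Springer
  1966, Thm. 4.5.1 (pp. 65–66). [Hirzebruch1966]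
* D. Husemoller, *Fibre Bundles*, 3rd ed., GTM 20, Springer 1994, Ch. 3 §2 (morphisms of
  bundles, fibrewise operations). [HusemollerFibreBundles1994]
-/

noncomputable section

open Function Set Bundle Topology Literature.AlgebraicTopology.SingularHomology

namespace Literature.AlgebraicTopology.CharacteristicClasses

/-! ### Fibres of vector bundles are topological vector spaces; fibrewise operations -/

section FibreOps

/-- **Addition is continuous on each fibre of a vector bundle** (the fibre is linearly homeomorphic
to the model fibre through the trivialisation at the point, Husemoller Ch. 3 §2).
[cite: HusemollerFibreBundles1994, Ch. 3 §2] -/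
theorem _root_.VectorBundle.continuousAdd_fiber (𝕜 : Type*) [NontriviallyNormedField 𝕜] {B : Type*}
    [TopologicalSpace B] (F : Type*) [NormedAddCommGroup F] [NormedSpace 𝕜 F] {V : B → Type*}
    [TopologicalSpace (TotalSpace F V)] [∀ b, AddCommMonoid (V b)] [∀ b, Module 𝕜 (V b)]
    [∀ b, TopologicalSpace (V b)] [FiberBundle F V] [VectorBundle 𝕜 F V] (b : B) : ContinuousAdd (V b) := by
  have hb : b ∈ (trivializationAt F V b).baseSet := mem_baseSet_trivializationAt F V b
  set L := (trivializationAt F V b).continuousLinearEquivAt 𝕜 b hb with hL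
  refine ⟨?_⟩
  have h : (fun p : V b × V b ↦ p.1 + p.2) = fun p ↦ L.symm (L p.1 + L p.2) := by
    funext p
    rw [← map_add, ContinuousLinearEquiv.symm_apply_apply]
  rw [h]
  exact L.symm.continuous.comp ((L.continuous.comp continuous_fst).add (L.continuous.comp continuous_snd))

/-- **Scalar multiplication by constants is continuous on each fibre of a vector bundle.**
[cite: HusemollerFibreBundles1994, Ch. 3 §2] -/
theorem _root_.VectorBundle.continuousConstSMul_fiber (𝕜 : Type*) [NontriviallyNormedField 𝕜] {B : Type*}
    [TopologicalSpace B] (F : Type*) [NormedAddCommGroup F] [NormedSpace 𝕜 F] {V : B → Type*}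
    [TopologicalSpace (TotalSpace F V)] [∀ b, AddCommMonoid (V b)] [∀ b, Module 𝕜 (V b)]
    [∀ b, TopologicalSpace (V b)] [FiberBundle F V] [VectorBundle 𝕜 F V] (b : B) : ContinuousConstSMul 𝕜 (V b) := by
  have hb : b ∈ (trivializationAt F V b).baseSet := mem_baseSet_trivializationAt F V b
  set L := (trivializationAt F V b).continuousLinearEquivAt 𝕜 b hb with hL
  refine ⟨fun c ↦ ?_⟩
  have h : (fun v : V b ↦ c • v) = fun v ↦ L.symm (c • L v) := by
    funext v
    rw [← ContinuousLinearEquiv.map_smul, ContinuousLinearEquiv.symm_apply_apply]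
  rw [h]
  exact L.symm.continuous.comp (L.continuous.const_smul c)

variable (𝕜 : Type*) [NontriviallyNormedField 𝕜] {B : Type*} [TopologicalSpace B]
  {F : Type*} [NormedAddCommGroup F] [NormedSpace 𝕜 F]
  {V : B → Type*} [TopologicalSpace (TotalSpace F V)] [∀ b, AddCommMonoid (V b)] [∀ b, Module 𝕜 (V b)]
  [∀ b, TopologicalSpace (V b)] [FiberBundle F V] [VectorBundle 𝕜 F V]

variable {X : Type*} [TopologicalSpace X] {b : X → B}

include 𝕜 in
/-- **The fibrewise combination `σ + c τ` of two continuous maps into a vector bundle (over any normed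
field) over the same base map, with a continuous scalar function `c`, is continuous** (read in a
local trivialisation; the real case `c = 1` is `Literature.Topology.FourManifolds.continuous_add_fibre`).
[cite: HusemollerFibreBundles1994, Ch. 3 §2] -/
theorem continuous_add_smul_fibre {σ τ : ∀ x, V (b x)} {c : X → 𝕜}
    (hσ : Continuous fun x ↦ (⟨b x, σ x⟩ : TotalSpace F V)) (hτ : Continuous fun x ↦ (⟨b x, τ x⟩ : TotalSpace F V))
    (hc : Continuous c) : Continuous fun x ↦ (⟨b x, σ x + c x • τ x⟩ : TotalSpace F V) := by
  have hb : Continuous b := (FiberBundle.continuous_proj F V).comp hσ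
  refine continuous_iff_continuousAt.2 fun x₀ ↦ ?_
  rw [FiberBundle.continuousAt_totalSpace]
  refine ⟨hb.continuousAt, ?_⟩
  set e := trivializationAt F V (b x₀) with he
  have hσ' := ((FiberBundle.continuousAt_totalSpace F _).1 (hσ.continuousAt (x := x₀))).2
  have hτ' := ((FiberBundle.continuousAt_totalSpace F _).1 (hτ.continuousAt (x := x₀))).2
  have hev : ∀ᶠ x in 𝓝 x₀, b x ∈ e.baseSet :=
    hb.continuousAt.preimage_mem_nhds (e.open_baseSet.mem_nhds (mem_baseSet_trivializationAt F V (b x₀)))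
  refine (hσ'.add (hc.continuousAt.smul hτ')).congr_of_eventuallyEq ?_
  filter_upwards [hev] with x hx
  show (e ⟨b x, σ x + c x • τ x⟩).2 = (e ⟨b x, σ x⟩).2 + c x • (e ⟨b x, τ x⟩).2
  rw [(e.linear 𝕜 hx).map_add, (e.linear 𝕜 hx).map_smul]

variable {𝕜} in
/-- **The fibrewise multiple of a continuous map into a vector bundle by a continuous scalar function
is continuous** (any normed field; the real case is `continuous_smul_fibre`).
[cite: HusemollerFibreBundles1994, Ch. 3 §2] -/
theorem continuous_smul_fibre' {σ : ∀ x, V (b x)} {c : X → 𝕜} (hc : Continuous c)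
    (hσ : Continuous fun x ↦ (⟨b x, σ x⟩ : TotalSpace F V)) :
    Continuous fun x ↦ (⟨b x, c x • σ x⟩ : TotalSpace F V) := by
  have hb : Continuous b := (FiberBundle.continuous_proj F V).comp hσ
  refine continuous_iff_continuousAt.2 fun x₀ ↦ ?_
  rw [FiberBundle.continuousAt_totalSpace]
  refine ⟨hb.continuousAt, ?_⟩
  set e := trivializationAt F V (b x₀) with he
  have hσ' := ((FiberBundle.continuousAt_totalSpace F _).1 (hσ.continuousAt (x := x₀))).2
  have hev : ∀ᶠ x in 𝓝 x₀, b x ∈ e.baseSet :=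
    hb.continuousAt.preimage_mem_nhds (e.open_baseSet.mem_nhds (mem_baseSet_trivializationAt F V (b x₀)))
  refine (hc.continuousAt.smul hσ').congr_of_eventuallyEq ?_
  filter_upwards [hev] with x hx
  exact (e.linear 𝕜 hx).map_smul _ _

end FibreOps

/-! ### The fibre isomorphism `V_x ⊗ ℂ ≅ E_x ⊕ Ē_x` of a real form -/

namespace Complexification

section SplitAlgebra

variable {W : Type*} [AddCommGroup W] [Module ℝ W] [TopologicalSpace W]
  {F' : Type*} [AddCommGroup F'] [Module ℂ F'] [Module ℝ F'] [IsScalarTower ℝ ℂ F'] [TopologicalSpace F']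
  (φ : W ≃L[ℝ] F')

omit [TopologicalSpace F'] in
/-- Real scalars act on the complex fibre through `ℝ ⊂ ℂ`. [folklore] -/
theorem real_smul_eq_coe_smul (r : ℝ) (y : F') : r • y = (r : ℂ) • y :=
  (algebraMap_smul ℂ r y).symm

/-- `i (c i) = -c` in the scalars. [folklore] -/
theorem I_mul_mul_I (c : ℂ) : Complex.I * (c * Complex.I) = -c := by
  rw [mul_left_comm, Complex.I_mul_I, mul_neg_one]

/-- The component `u + i v ↦ φ u + i φ v ∈ E_x` of the splitting. [cite: MilnorStasheffAMS76, Lemma 15.4] -/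
def rfPlus (w : Complexification W) : F' := φ w.re + Complex.I • φ w.im

/-- The component `u + i v ↦ (φ u - i φ v)‾ ∈ Ē_x` of the splitting. [cite: MilnorStasheffAMS76, Lemma 15.4] -/
def rfMinus (w : Complexification W) : Conj F' := Conj.toConj (φ w.re + (-Complex.I) • φ w.im)

/-- The inverse `(a, b̄) ↦ φ⁻¹(½ (a + b)) + i φ⁻¹((i/2) (b - a))` of the splitting.
[cite: MilnorStasheffAMS76, Lemma 15.4] -/
def rfInv (p : F' × Conj F') : Complexification W :=
  Complexification.mk (φ.symm ((2⁻¹ : ℂ) • (p.1 + Conj.ofConj p.2)))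
    (φ.symm ((2⁻¹ : ℂ) • ((-Complex.I) • p.1 + Complex.I • Conj.ofConj p.2)))

omit [TopologicalSpace W] [TopologicalSpace F'] in
/-- An `ℝ`-linear map into the complex fibre on `a • u - b • v`. [folklore] -/
theorem map_real_comb (f : W →ₗ[ℝ] F') (a b : ℝ) (u v : W) :
    f (a • u - b • v) = (a : ℂ) • f u - (b : ℂ) • f v := by
  rw [map_sub, map_smul, map_smul, real_smul_eq_coe_smul, real_smul_eq_coe_smul]

omit [TopologicalSpace W] [TopologicalSpace F'] in
/-- An `ℝ`-linear map into the complex fibre on `a • u + b • v`. [folklore] -/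
theorem map_real_comb' (f : W →ₗ[ℝ] F') (a b : ℝ) (u v : W) :
    f (a • u + b • v) = (a : ℂ) • f u + (b : ℂ) • f v := by
  rw [map_add, map_smul, map_smul, real_smul_eq_coe_smul, real_smul_eq_coe_smul]

omit [IsScalarTower ℝ ℂ F'] in
/-- `rfPlus` is additive. [folklore] -/
theorem rfPlus_add (w w' : Complexification W) : rfPlus φ (w + w') = rfPlus φ w + rfPlus φ w' := by
  simp only [rfPlus, Complexification.re_add, Complexification.im_add, map_add, smul_add]
  abel

omit [IsScalarTower ℝ ℂ F'] in
/-- `rfMinus` is additive. [folklore] -/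
theorem rfMinus_add (w w' : Complexification W) : rfMinus φ (w + w') = rfMinus φ w + rfMinus φ w' := by
  simp only [rfMinus, Complexification.re_add, Complexification.im_add, map_add, smul_add, ← Conj.toConj_add]
  congr 1
  abel

/-- `rfPlus` is complex linear. [cite: MilnorStasheffAMS76, Lemma 15.4] -/
theorem rfPlus_smul (z : ℂ) (w : Complexification W) : rfPlus φ (z • w) = z • rfPlus φ w := by
  have h1 : φ (z • w).re = (z.re : ℂ) • φ w.re - (z.im : ℂ) • φ w.im := by
    rw [Complexification.re_smul]; exact map_real_comb (φ : W →ₗ[ℝ] F') _ _ _ _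
  have h2 : φ (z • w).im = (z.re : ℂ) • φ w.im + (z.im : ℂ) • φ w.re := by
    rw [Complexification.im_smul]; exact map_real_comb' (φ : W →ₗ[ℝ] F') _ _ _ _
  simp only [rfPlus, h1, h2]
  conv_rhs => rw [← Complex.re_add_im z]
  simp only [add_smul, mul_smul, smul_add]
  simp only [smul_smul, Complex.I_mul_I, neg_smul, one_smul, smul_neg]
  module

/-- `rfMinus` is complex linear (into the conjugate structure). [cite: MilnorStasheffAMS76, Lemma 15.4] -/
theorem rfMinus_smul (z : ℂ) (w : Complexification W) : rfMinus φ (z • w) = z • rfMinus φ w := by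
  have h1 : φ (z • w).re = (z.re : ℂ) • φ w.re - (z.im : ℂ) • φ w.im := by
    rw [Complexification.re_smul]; exact map_real_comb (φ : W →ₗ[ℝ] F') _ _ _ _
  have h2 : φ (z • w).im = (z.re : ℂ) • φ w.im + (z.im : ℂ) • φ w.re := by
    rw [Complexification.im_smul]; exact map_real_comb' (φ : W →ₗ[ℝ] F') _ _ _ _
  simp only [rfMinus, h1, h2]
  rw [Conj.smul_def, Conj.ofConj_toConj]
  congr 1
  conv_rhs => rw [← Complex.re_add_im z]
  simp only [map_add, map_mul, Complex.conj_ofReal, Complex.conj_I]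
  simp only [add_smul, mul_smul, smul_add]
  simp only [smul_smul, neg_mul, Complex.I_mul_I, neg_neg, neg_smul, one_smul, smul_neg]
  module

omit [IsScalarTower ℝ ℂ F'] in
/-- `rfInv` is a left inverse. [cite: MilnorStasheffAMS76, Lemma 15.4] -/
theorem rfInv_apply (w : Complexification W) : rfInv φ (rfPlus φ w, rfMinus φ w) = w := by
  apply Complexification.ext
  · change φ.symm ((2⁻¹ : ℂ) • ((φ w.re + Complex.I • φ w.im) +
      Conj.ofConj (Conj.toConj (φ w.re + (-Complex.I) • φ w.im)))) = w.re
    rw [Conj.ofConj_toConj, ← φ.symm_apply_apply w.re]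
    congr 1
    rw [φ.symm_apply_apply]
    simp only [smul_add]
    simp only [smul_smul, mul_neg]
    module
  · change φ.symm ((2⁻¹ : ℂ) • ((-Complex.I) • (φ w.re + Complex.I • φ w.im) +
      Complex.I • Conj.ofConj (Conj.toConj (φ w.re + (-Complex.I) • φ w.im)))) = w.im
    rw [Conj.ofConj_toConj, ← φ.symm_apply_apply w.im]
    congr 1
    rw [φ.symm_apply_apply]
    simp only [smul_add]
    simp only [smul_smul, mul_neg, neg_mul, Complex.I_mul_I, neg_neg, one_smul]
    module

omit [IsScalarTower ℝ ℂ F'] in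
/-- `rfInv` is a right inverse. [cite: MilnorStasheffAMS76, Lemma 15.4] -/
theorem apply_rfInv (p : F' × Conj F') : (rfPlus φ (rfInv φ p), rfMinus φ (rfInv φ p)) = p := by
  obtain ⟨a, b⟩ := p
  refine Prod.ext ?_ ?_
  · change φ (φ.symm _) + Complex.I • φ (φ.symm _) = a
    rw [φ.apply_symm_apply, φ.apply_symm_apply]
    simp only [smul_add]
    simp only [smul_smul, mul_neg, neg_neg, I_mul_mul_I]
    module
  · change Conj.toConj (φ (φ.symm _) + (-Complex.I) • φ (φ.symm _)) = b
    rw [φ.apply_symm_apply, φ.apply_symm_apply]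
    conv_rhs => rw [← Conj.toConj_ofConj b]
    congr 1
    simp only [smul_add]
    simp only [smul_smul, mul_neg, neg_mul, neg_neg, I_mul_mul_I]
    module

variable [ContinuousAdd F'] [ContinuousConstSMul ℂ F']

/-- **The fibre of `V ⊗ ℂ` splits as `E_x ⊕ Ē_x` along a real form `φ_x : V_x ≅ E_x`**: the
complex-linear isomorphism `u + i v ↦ (φ u + i φ v, (φ u - i φ v)‾)` (Milnor–Stasheff Lemma 15.4;
Hirzebruch's unitary change of basis in the proof of Thm. 4.5.1).
[cite: MilnorStasheffAMS76, Lemma 15.4] -/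
def realFormSplitEquiv : Complexification W ≃L[ℂ] (F' × Conj F') where
  toFun w := (rfPlus φ w, rfMinus φ w)
  invFun := rfInv φ
  map_add' w w' := Prod.ext (rfPlus_add φ w w') (rfMinus_add φ w w')
  map_smul' z w := Prod.ext (rfPlus_smul φ z w) (rfMinus_smul φ z w)
  left_inv w := rfInv_apply φ w
  right_inv p := apply_rfInv φ p
  continuous_toFun := by
    refine Continuous.prodMk ?_ ?_
    · exact (φ.continuous.comp Complexification.continuous_re).add
        ((φ.continuous.comp Complexification.continuous_im).const_smul _)
    · exact Conj.continuous_toConj.comp ((φ.continuous.comp Complexification.continuous_re).add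
        ((φ.continuous.comp Complexification.continuous_im).const_smul _))
  continuous_invFun := by
    have h1 : Continuous fun p : F' × Conj F' ↦ p.1 := continuous_fst
    have h2 : Continuous fun p : F' × Conj F' ↦ Conj.ofConj p.2 := Conj.continuous_ofConj.comp continuous_snd
    refine (Complexification.continuous_iff _).2 ⟨?_, ?_⟩
    · exact φ.symm.continuous.comp ((h1.add h2).const_smul _)
    · exact φ.symm.continuous.comp (((h1.const_smul _).add (h2.const_smul _)).const_smul _)

/-- The splitting on vectors (first component). [folklore] -/
@[simp] theorem realFormSplitEquiv_apply_fst (w : Complexification W) :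
    (realFormSplitEquiv φ w).1 = φ w.re + Complex.I • φ w.im := rfl

/-- The splitting on vectors (second component). [folklore] -/
@[simp] theorem realFormSplitEquiv_apply_snd (w : Complexification W) :
    (realFormSplitEquiv φ w).2 = Conj.toConj (φ w.re + (-Complex.I) • φ w.im) := rfl

/-- The inverse splitting (real part). [folklore] -/
theorem realFormSplitEquiv_symm_apply_re (p : F' × Conj F') :
    ((realFormSplitEquiv φ).symm p).re = φ.symm ((2⁻¹ : ℂ) • (p.1 + Conj.ofConj p.2)) := rfl

/-- The inverse splitting (imaginary part). [folklore] -/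
theorem realFormSplitEquiv_symm_apply_im (p : F' × Conj F') :
    ((realFormSplitEquiv φ).symm p).im = φ.symm ((2⁻¹ : ℂ) • ((-Complex.I) • p.1 + Complex.I • Conj.ofConj p.2)) := rfl

end SplitAlgebra

/-! ### Milnor–Stasheff Lemma 15.4: `V ⊗ ℂ ≅ E ⊕ Ē` for a real form `V` of `E` -/

section Bundle

open ComplexVectorBundle

variable {B : Type} [TopologicalSpace B]
  (F₁ : Type) [NormedAddCommGroup F₁] [NormedSpace ℝ F₁] [FiniteDimensional ℝ F₁]
  (V : B → Type) [TopologicalSpace (TotalSpace F₁ V)] [∀ x, AddCommGroup (V x)] [∀ x, Module ℝ (V x)]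
  [∀ x, TopologicalSpace (V x)] [FiberBundle F₁ V] [VectorBundle ℝ F₁ V]
  (E : ComplexVectorBundle.{0, 0} B) [∀ x, Module ℝ (E.E x)] [∀ x, IsScalarTower ℝ ℂ (E.E x)]
  (φ : ∀ x, V x ≃L[ℝ] E.E x)
  (hφ : Continuous fun p : TotalSpace F₁ V ↦ (⟨p.proj, φ p.proj p.snd⟩ : TotalSpace E.F E.E))
  (hφ' : Continuous fun q : TotalSpace E.F E.E ↦ (⟨q.proj, (φ q.proj).symm q.snd⟩ : TotalSpace F₁ V))

omit [FiniteDimensional ℝ F₁] [FiberBundle F₁ V] [VectorBundle ℝ F₁ V] [∀ x, IsScalarTower ℝ ℂ (E.E x)] in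
include hφ in
/-- The map `u + i v ↦ φ(u) + c φ(v)` of total spaces `V ⊗ ℂ → E` is continuous for a constant complex
coefficient `c`. [cite: HusemollerFibreBundles1994, Ch. 3 §2] -/
theorem continuous_realForm_comb (c : ℂ) :
    Continuous fun p : TotalSpace (CModel F₁) (fun x ↦ Complexification (V x)) ↦
      (⟨p.proj, φ p.proj p.snd.re + c • φ p.proj p.snd.im⟩ : TotalSpace E.F E.E) := by
  have hre : Continuous fun p : TotalSpace (CModel F₁) (fun x ↦ Complexification (V x)) ↦
      (⟨p.proj, φ p.proj p.snd.re⟩ : TotalSpace E.F E.E) := hφ.comp (Complexification.continuous_reTotal F₁ V)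
  have him : Continuous fun p : TotalSpace (CModel F₁) (fun x ↦ Complexification (V x)) ↦
      (⟨p.proj, φ p.proj p.snd.im⟩ : TotalSpace E.F E.E) := hφ.comp (Complexification.continuous_imTotal F₁ V)
  exact continuous_add_smul_fibre ℂ (F := E.F) (V := E.E) hre him continuous_const

omit [NormedAddCommGroup F₁] [NormedSpace ℝ F₁] [FiniteDimensional ℝ F₁] [FiberBundle F₁ V] [VectorBundle ℝ F₁ V]
  [∀ x, IsScalarTower ℝ ℂ (E.E x)] in
include hφ' in
/-- The map `(a, b̄) ↦ φ⁻¹(c (c₁ a + c₂ b))` of total spaces `E ⊕ Ē → V` is continuous for constant complex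
coefficients. [cite: HusemollerFibreBundles1994, Ch. 3 §2] -/
theorem continuous_realFormInv_comb (c c₁ c₂ : ℂ) :
    Continuous fun q : TotalSpace (E.F × Conj E.F) (fun x ↦ E.E x × Conj (E.E x)) ↦
      (⟨q.proj, (φ q.proj).symm (c • (c₁ • q.snd.1 + c₂ • Conj.ofConj q.snd.2))⟩ : TotalSpace F₁ V) := by
  have hd := (FiberBundle.Prod.isInducing_diag E.F E.E (Conj E.F) (fun x ↦ Conj (E.E x))).continuous
  have h1 : Continuous fun q : TotalSpace (E.F × Conj E.F) (fun x ↦ E.E x × Conj (E.E x)) ↦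
      (⟨q.proj, q.snd.1⟩ : TotalSpace E.F E.E) := continuous_fst.comp hd
  have h2 : Continuous fun q : TotalSpace (E.F × Conj E.F) (fun x ↦ E.E x × Conj (E.E x)) ↦
      (⟨q.proj, Conj.ofConj q.snd.2⟩ : TotalSpace E.F E.E) :=
    (Conj.totalHomeomorph E.F E.E).continuous.comp (continuous_snd.comp hd)
  have hsum : Continuous fun q : TotalSpace (E.F × Conj E.F) (fun x ↦ E.E x × Conj (E.E x)) ↦
      (⟨q.proj, c • (c₁ • q.snd.1 + c₂ • Conj.ofConj q.snd.2)⟩ : TotalSpace E.F E.E) :=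
    continuous_smul_fibre' (F := E.F) (V := E.E) continuous_const
      (continuous_add_smul_fibre ℂ (F := E.F) (V := E.E)
        (continuous_smul_fibre' (F := E.F) (V := E.E) continuous_const h1) h2 continuous_const)
  exact hφ'.comp hsum

/-- **Milnor–Stasheff Lemma 15.4: the complexification of a real form `V` of the complex bundle `E` is
`E ⊕ Ē`**, `V ⊗ ℂ ≅ E ⊕ Ē` as complex vector bundles over `B`, fibrewise `realFormSplitEquiv`
(`u + i v ↦ (φ u + i φ v, (φ u - i φ v)‾)`); both total maps are fibrewise constant-coefficient
combinations of the continuous real form `φ` and its inverse. [cite: MilnorStasheffAMS76, Lemma 15.4]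
[cite: Hirzebruch1966, Thm. 4.5.1 (proof, p. 66)] -/
def realFormIso : (complexified F₁ V).Iso (E.directSum E.conjugate) where
  equiv x :=
    haveI := VectorBundle.continuousAdd_fiber ℂ E.F (V := E.E) x
    haveI := VectorBundle.continuousConstSMul_fiber ℂ E.F (V := E.E) x
    realFormSplitEquiv (φ x)
  continuous_toFun := by
    refine (FiberBundle.Prod.isInducing_diag E.F E.E (Conj E.F) (fun x ↦ Conj (E.E x))).continuous_iff.2
      (Continuous.prodMk ?_ ?_)
    · exact continuous_realForm_comb F₁ V E φ hφ Complex.I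
    · exact (Conj.continuous_total_iff E.F E.E _).2 (continuous_realForm_comb F₁ V E φ hφ (-Complex.I))
  continuous_invFun := by
    refine (Complexification.continuous_total_iff F₁ V _).2 ⟨?_, ?_⟩
    · have h := continuous_realFormInv_comb F₁ V E φ hφ' 2⁻¹ 1 1
      refine h.congr fun q ↦ ?_
      simp only [one_smul]
      rfl
    · exact continuous_realFormInv_comb F₁ V E φ hφ' 2⁻¹ (-Complex.I) Complex.I

end Bundle

end Complexification

/-! ### Cor. 15.5 / Thm. 4.5.1: the Pontryagin classes of a real form from the Chern classes -/

section PontryaginOfRealForm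

variable {B : Type} [TopologicalSpace B]
  (F₁ : Type) [NormedAddCommGroup F₁] [NormedSpace ℝ F₁] [FiniteDimensional ℝ F₁]
  (V : B → Type) [TopologicalSpace (TotalSpace F₁ V)] [∀ x, AddCommGroup (V x)] [∀ x, Module ℝ (V x)]
  [∀ x, TopologicalSpace (V x)] [FiberBundle F₁ V] [VectorBundle ℝ F₁ V]
  (E : ComplexVectorBundle.{0, 0} B) [∀ x, Module ℝ (E.E x)] [∀ x, IsScalarTower ℝ ℂ (E.E x)]
  (φ : ∀ x, V x ≃L[ℝ] E.E x)
  (hφ : Continuous fun p : TotalSpace F₁ V ↦ (⟨p.proj, φ p.proj p.snd⟩ : TotalSpace E.F E.E))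
  (hφ' : Continuous fun q : TotalSpace E.F E.E ↦ (⟨q.proj, (φ q.proj).symm q.snd⟩ : TotalSpace F₁ V))

include hφ hφ' in
/-- **`pᵢ(V) = (-1)ⁱ c₂ᵢ(E ⊕ Ē)` for a real form `V` of `E`** ((C₁) applied to `V ⊗ ℂ ≅ E ⊕ Ē`).
[cite: MilnorStasheffAMS76, Cor. 15.5] -/
theorem pontryaginClass_eq_of_realForm [T2Space B] [ParacompactSpace B] (i : ℕ) :
    pontryaginClass F₁ V i =
      (-1 : ℤ) ^ i • degCast ℤ (show 2 * (2 * i) = 4 * i by ring) (chernClassZ (E.directSum E.conjugate) (2 * i)) := by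
  rw [pontryaginClass_def, chernClassZ_eq, chernClassZ_eq,
    ComplexVectorBundle.chernClassR_congr ℤ (Complexification.realFormIso F₁ V E φ hφ hφ') (2 * i)]

/-- **`c₂(E ⊕ Ē) = 2 c₂(E) - c₁(E) ⌣ c₁(E)`** — the Whitney sum formula with `c₁(Ē) = -c₁(E)`,
`c₂(Ē) = c₂(E)` (Hirzebruch Thm. 4.5.1 in degree `4`: the coefficient of `z²` in
`(1 + c₁ z + c₂ z²)(1 - c₁ z + c₂ z²)`). [cite: Hirzebruch1966, Thm. 4.5.1 (p. 66)] -/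
theorem chernClassZ_two_directSum_conjugate [T2Space B] [ParacompactSpace B] (E : ComplexVectorBundle.{0, 0} B) :
    chernClassZ (E.directSum E.conjugate) 2 =
      chernClassZ E 2 + chernClassZ E 2 - cupEven (show 1 + 1 = 2 from rfl) (chernClassZ E 1) (chernClassZ E 1) := by
  have h2 := theChernClassTheory.chernClass_directSum E E.conjugate 2
  have hu : (Finset.univ : Finset (Finset.HasAntidiagonal.antidiagonal 2)) =
      {⟨(0, 2), by simp⟩, ⟨(1, 1), by simp⟩, ⟨(2, 0), by simp⟩} := by decide
  rw [hu, Finset.sum_insert (by decide), Finset.sum_pair (by decide)] at h2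
  refine h2.trans ?_
  change cupEven _ (chernClassZ _ 0) (chernClassZ _ 2) +
    (cupEven _ (chernClassZ _ 1) (chernClassZ _ 1) + cupEven _ (chernClassZ _ 2) (chernClassZ _ 0)) = _
  rw [chernClassZ_zero, chernClassZ_zero, chernClassZ_conjugate_two, chernClassZ_conjugate_one, map_neg]
  have e1 : cupEven (show 0 + 2 = 2 from rfl) (singularCohomology.one ℤ B) (chernClassZ E 2) = chernClassZ E 2 :=
    one_cupProduct _
  have e2 : cupEven (show 2 + 0 = 2 from rfl) (chernClassZ E 2) (singularCohomology.one ℤ B) = chernClassZ E 2 :=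
    cupProduct_one _
  rw [e1, e2]
  abel

/-- Composition of degree casts. [folklore] -/
theorem degCast_degCast (R : Type) [CommRing R] {X : Type} [TopologicalSpace X] {a b c : ℕ} (e₁ : a = b) (e₂ : b = c)
    (y : singularCohomology R R X a) : degCast R e₂ (degCast R e₁ y) = degCast R (e₁.trans e₂) y := by
  subst e₁; subst e₂; rfl

include hφ hφ' in
/-- **Milnor–Stasheff Cor. 15.5 / Hirzebruch Thm. 4.5.1 in degree four: `p₁(V) = c₁(E) ⌣ c₁(E) - 2 c₂(E)`
for a real form `V` of the complex bundle `E`** (over a paracompact Hausdorff base; both sides cast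
to `H⁴(B; ℤ)`). [cite: MilnorStasheffAMS76, Cor. 15.5] [cite: Hirzebruch1966, Thm. 4.5.1 (p. 66)] -/
theorem pontryaginClass_one_eq_of_realForm [T2Space B] [ParacompactSpace B] :
    degCast ℤ (show 4 * 1 = 4 by norm_num) (pontryaginClass F₁ V 1) =
      degCast ℤ (show 2 * 2 = 4 by norm_num)
        (cupEven (show 1 + 1 = 2 from rfl) (chernClassZ E 1) (chernClassZ E 1) - (2 : ℤ) • chernClassZ E 2) := by
  rw [pontryaginClass_eq_of_realForm F₁ V E φ hφ hφ' 1]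
  change degCast ℤ (show 4 * 1 = 4 by norm_num) ((-1 : ℤ) ^ 1 • degCast ℤ (show 2 * 2 = 4 * 1 by norm_num)
    (chernClassZ (E.directSum E.conjugate) 2)) = _
  rw [chernClassZ_two_directSum_conjugate, pow_one, neg_one_zsmul, map_neg, degCast_degCast, ← map_neg]
  congr 1
  abel

end PontryaginOfRealForm

end Literature.AlgebraicTopology.CharacteristicClasses
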